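import Literature.AnabelianGeometry.EtaleTheta.Discharge.Sec1EvalAtNaturality
import Literature.AnabelianGeometry.EtaleTheta.Discharge.Sec1StandardType
import Literature.AnabelianGeometry.EtaleTheta.ThetaCohomologyAnchored
import Literature.AnabelianGeometry.EtaleTheta.ConstantMultipleRigiditySub
import Literature.AnabelianGeometry.EtaleTheta.Thm16SubdagTransport
import HarnessLib

/-!
# [EtTh] Thm. 1.10 (ii) from the transport of CONSTANTS and of the DECOMPOSITION GROUPS of `τ^{±1}`
# (K2 rows T110.ii.r5/r6: the «naturality of evaluation across γ» is derivable for anchored points)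

S. Mochizuki, *The étale theta function …*, Publ. RIMS 45 (2009), §1, Thm. 1.10 (ii) p.256 («The
isomorphism `K^×_α →̃ K^×_β` … induced by `γ` preserves the standard sets of values of `η̈^{Θ,Z}_☐`»), its
proof p.256 («by considering the decomposition groups of the torsion points …»), Def. 1.9 (i) p.255,
Prop. 1.4 (iii) p.248 [cite: MochizukiEtTh2009, Thm 1.10 (ii) p.30].  PROOF-ONLY companion (no `def`) of
this seat's gen-0 `ConstantMultipleRigiditySub.lean` (p417168: `Thm110DecompTransport`, `Thm110DeltaInduced`,
`Thm110ValuesForward/Backward`, `thm110ii_of_valuesForward`), abc-iut-L2-t1's `ThetaCohomologyAnchored.lean`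
(p421374: `AnchoredPoint`, `AnchoredStandardData`), `TemperedRigidity.lean` (`ThetaSetting.transport`) and
`Thm16SubdagTransport.lean` (`Thm16Sub.companionSymm`, `transport_symm_transport`).  Cell sub-DAG
plan/L2/SUBDAG-EtTh-Thm110.md (K2), holder abc-iut-w5-d140.

The gen-0 docstring of `Thm110ValuesForward` called the naturality of evaluation across `γ` carrier-less
(`evalAt` is free data per point); for ANCHORED points (abc-iut-L2-t1's repair) it IS derivable — every class
on `D_y` is a restricted constant class, and constants are transported by `δ` (`Thm110DeltaInduced`).  Here:
* §A `ThetaSetting.exists_transportAt` — transport along `(γ, γ^Θ)` at the level of a decomposition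
  subgroup, compatible with restriction (cocycle-level construction, as `ThetaSetting.transport`);
  `ThetaSetting.transport_conj` — transport intertwines the conjugation actions: `T(σ·x) = γ(σ)·T(x)`;
* §B `MuTwoSetting.evalAt_transport_eq` — VALUES TRANSPORT: for an anchored `yα`, any point `yβ` with
  `σ D_{yβ} σ⁻¹ ⊆ γ(D_{yα})`, and `δ` induced by `γ` on constants: `value_{yβ}(σ⁻¹·T x) = δ(value_{yα}(x))`;
  `MuTwoSetting.image_valuesAt_subset` — hence `δ(values of x at yα) ⊆ values of T x at yβ`;
* §C the two-sided statement by symmetry (`γ⁻¹`, `δ⁻¹`, abc-iut's `transport_symm_transport`), and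
  **`thm110ValuesForward_of_decompTransport`**, **`thm110ii_of_decompTransport`**: the typed F-0514
  `Thm110ii H Aα.toStandardData Aβ.toStandardData` from {`Thm110DeltaInduced H δ` (the constant-field
  isomorphism induced by `γ`, Thm. 1.10 (ii) first clause / Thm. 1.6 (ii)), the decomposition-group transport of
  the anchored points `τ`, `τ⁻¹` (the `Thm110DecompTransport` shape), `Prop15ii` on both sides} — NO statement
  about values of the theta function.  HONEST FRAMING: typed ≠ proved for [EtTh]; the named inputs are
  hypotheses BY NAME; nothing here bears on the disputed [IUTchIII] Cor. 3.12.
-/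

noncomputable section

namespace Literature.AnabelianGeometry.EtaleTheta

open Literature.AnabelianGeometry.SemiGraphs
open scoped IsMulCommutative

variable {p : ℕ} [Fact p.Prime]

namespace ThetaSetting

variable {Dα Dβ : ThetaSetting p} {γ : Dα.PiTemp ≃ₜ* Dβ.PiTemp}

/-! ## §A. Transport at the level of a decomposition subgroup; equivariance -/

/-- **Transport along `(γ, γ^Θ)` at the level of a subgroup**: for `Hα ≤ Π^tp_{Ÿα}` and any
`Hβ ≤ Π^tp_{Ÿβ}` with `γ⁻¹(Hβ) ⊆ Hα` there is a homomorphism `T : H¹(Hα, Δ_Θα) → H¹(Hβ, Δ_Θβ)`,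
`[f] ↦ [γ^Θ ∘ f ∘ γ⁻¹]`, with `T (x|_{Hα}) = (transport x)|_{Hβ}` — the cocycle-level construction of
`ThetaSetting.transport` (Thm. 1.6 (iii) p.24) one level down. [cite: MochizukiEtTh2009, Thm 1.6 (iii) p.24] -/
theorem exists_transportAt (c : ThetaCompanion γ) (h : Thm16i γ) {Hα : Subgroup Dα.PiTemp}
    (hHα : Hα ≤ Dα.GtpYdd) {Hβ : Subgroup Dβ.PiTemp} (hHβ : Hβ ≤ Dβ.GtpYdd)
    (hmap : ∀ k : Dβ.PiTemp, k ∈ Hβ → γ.toMulEquiv.symm k ∈ Hα) :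
    ∃ T : Dα.H1 Hα →* Dβ.H1 Hβ, ∀ x : Dα.H1 Dα.GtpYdd,
      T (ContH1.res Dα.toTheta Dα.DeltaTheta hHα x) =
        ContH1.res Dβ.toTheta Dβ.DeltaTheta hHβ (transport c h x) := by
  have hγs : Continuous fun x : Dβ.PiTemp => γ.toMulEquiv.symm x := γ.continuous_invFun
  -- the point map `Hβ → Hα`, `k ↦ γ⁻¹ k`
  let ι : Hβ → Hα := fun k => ⟨γ.toMulEquiv.symm k.1, hmap k.1 k.2⟩
  have hι_cont : Continuous ι := ((hγs.comp continuous_subtype_val).subtype_mk _)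
  have hι_mul : ∀ k k' : Hβ, ι (k * k') = ι k * ι k' := fun k k' => Subtype.ext (by
    simp only [ι, Subgroup.coe_mul, map_mul])
  have hθ : ∀ k : Hβ, Dβ.toTheta (k : Dβ.PiTemp) =
      c.thetaIso.toMulEquiv (Dα.toTheta ((ι k : Hα) : Dα.PiTemp)) := fun k => by
    rw [← c.comm, MulEquiv.apply_symm_apply]
  -- transport of cocycles
  let tc : contCocycles Dα.toTheta Dα.DeltaTheta Hα →* contCocycles Dβ.toTheta Dβ.DeltaTheta Hβ :=
    { toFun := fun f => ⟨fun k => ⟨c.thetaIso (f.1 (ι k)).1, c.apply_mem _⟩, by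
        refine ⟨?_, fun x y => ?_⟩
        · apply continuous_induced_rng.2
          change Continuous fun k : Hβ => (c.thetaIso.toMulEquiv (f.1 (ι k)).1 : Dβ.GtpTheta)
          exact (map_continuous c.thetaIso).comp (continuous_subtype_val.comp (f.2.1.comp hι_cont))
        · apply Subtype.ext
          change (c.thetaIso.toMulEquiv (f.1 (ι (x * y))).1 : Dβ.GtpTheta) =
            c.thetaIso.toMulEquiv (f.1 (ι x)).1 *
              (Dβ.toTheta (x : Dβ.PiTemp) * c.thetaIso.toMulEquiv (f.1 (ι y)).1 *
                (Dβ.toTheta (x : Dβ.PiTemp))⁻¹)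
          rw [hι_mul, f.2.2]
          simp only [Subgroup.coe_mul, MulAut.conjNormal_apply, map_mul, map_inv, hθ]⟩
      map_one' := Subtype.ext (funext fun k => Subtype.ext (by
        change (c.thetaIso.toMulEquiv (1 : Dα.DeltaTheta).1 : Dβ.GtpTheta) = 1
        simp))
      map_mul' := fun f g => Subtype.ext (funext fun k => Subtype.ext (by
        change (c.thetaIso.toMulEquiv ((f.1 _ * g.1 _ : Dα.DeltaTheta)).1 : Dβ.GtpTheta) = _
        simp only [Subgroup.coe_mul, map_mul]
        rfl)) }
  -- it preserves coboundaries, hence descends to `H¹`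
  let T : Dα.H1 Hα →* Dβ.H1 Hβ :=
    QuotientGroup.map _ _ tc (by
      intro f hf
      obtain ⟨a, ha⟩ := (mem_contCoboundaries_iff _).mp (Subgroup.mem_subgroupOf.mp hf)
      refine Subgroup.mem_subgroupOf.mpr ((mem_contCoboundaries_iff _).mpr
        ⟨⟨c.thetaIso.toMulEquiv a.1, c.apply_mem a⟩, ?_⟩)
      funext k
      apply Subtype.ext
      change (c.thetaIso.toMulEquiv (f.1 (ι k)).1 : Dβ.GtpTheta) = _
      rw [congrFun ha (ι k)]
      simp only [Subgroup.coe_mul, Subgroup.coe_inv, MulAut.conjNormal_apply, map_mul, map_inv, hθ])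
  refine ⟨T, fun x => ?_⟩
  induction x using QuotientGroup.induction_on with
  | H f =>
    change (QuotientGroup.mk (tc (ContH1.resCocycle Dα.toTheta Dα.DeltaTheta hHα f)) : Dβ.H1 Hβ) =
      QuotientGroup.mk (ContH1.resCocycle Dβ.toTheta Dβ.DeltaTheta hHβ (transportCocycle c h f))
    -- both sides are the class of `k ↦ γ^Θ (f (γ⁻¹ k))` (definitionally)
    rfl

/-- **Transport intertwines the conjugation actions**: `T(σ·x) = γ(σ)·T(x)` for `σ ∈ Π^tp_{Xα}` — "the
isomorphism of cohomology groups induced by `γ`" is `γ`-equivariant (both sides are the class of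
`k ↦ γ^Θ(φ(σ) f(σ⁻¹ γ⁻¹(k) σ) φ(σ)⁻¹)`, using `(·)^Θ ∘ γ = γ^Θ ∘ (·)^Θ`). [cite: MochizukiEtTh2009, Thm 1.6 (iii) p.24] -/
theorem transport_conj [Dα.GtpYdd.Normal] [Dβ.GtpYdd.Normal] (c : ThetaCompanion γ) (h : Thm16i γ)
    (σ : Dα.PiTemp) (x : Dα.H1 Dα.GtpYdd) :
    transport c h (ContH1.conj Dα.toTheta Dα.DeltaTheta σ x) =
      ContH1.conj Dβ.toTheta Dβ.DeltaTheta (γ.toMulEquiv σ) (transport c h x) := by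
  induction x using QuotientGroup.induction_on with
  | H f =>
    change (QuotientGroup.mk (transportCocycle c h (ContH1.conjCocycle Dα.toTheta Dα.DeltaTheta σ f)) :
        Dβ.H1 Dβ.GtpYdd) =
      QuotientGroup.mk (ContH1.conjCocycle Dβ.toTheta Dβ.DeltaTheta (γ.toMulEquiv σ)
        (transportCocycle c h f))
    congr 1
    apply Subtype.ext
    funext k
    -- the two points of `Π^tp_{Ÿα}` at which `f` is evaluated coincide
    have hpt : MulAut.conjNormal σ⁻¹
        (⟨γ.toMulEquiv.symm k.1, symm_mem_GtpYdd h k⟩ : Dα.GtpYdd) =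
        ⟨γ.toMulEquiv.symm (MulAut.conjNormal (γ.toMulEquiv σ)⁻¹ k).1,
          symm_mem_GtpYdd h (MulAut.conjNormal (γ.toMulEquiv σ)⁻¹ k)⟩ := by
      apply Subtype.ext
      change σ⁻¹ * γ.toMulEquiv.symm k.1 * σ⁻¹⁻¹ =
        γ.toMulEquiv.symm ((γ.toMulEquiv σ)⁻¹ * k.1 * (γ.toMulEquiv σ)⁻¹⁻¹)
      rw [inv_inv, inv_inv, map_mul, map_mul, map_inv, MulEquiv.symm_apply_apply]
    have hθσ : Dβ.toTheta (γ.toMulEquiv σ) = c.thetaIso.toMulEquiv (Dα.toTheta σ) := c.comm σ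
    apply Subtype.ext
    change (c.thetaIso.toMulEquiv (MulAut.conjNormal (Dα.toTheta σ)
        (f.1 (MulAut.conjNormal σ⁻¹ ⟨γ.toMulEquiv.symm k.1, symm_mem_GtpYdd h k⟩))).1 : Dβ.GtpTheta) =
      Dβ.toTheta (γ.toMulEquiv σ : Dβ.PiTemp) *
        c.thetaIso.toMulEquiv (f.1 ⟨γ.toMulEquiv.symm (MulAut.conjNormal (γ.toMulEquiv σ)⁻¹ k).1,
          symm_mem_GtpYdd h (MulAut.conjNormal (γ.toMulEquiv σ)⁻¹ k)⟩).1 *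
        (Dβ.toTheta (γ.toMulEquiv σ : Dβ.PiTemp))⁻¹
    rw [hpt, MulAut.conjNormal_apply, map_mul, map_mul, map_inv, hθσ, map_inv]

end ThetaSetting

/-! ## §B. Values transport for anchored points -/

namespace MuTwoSetting

variable {Mα Mβ : MuTwoSetting p} {γ : Mα.PiTemp ≃ₜ* Mβ.PiTemp}
  {Eα : Mα.toThetaSetting.KummerData} {Eβ : Mβ.toThetaSetting.KummerData}

/-- **Values transport.**  Let `yα` be an ANCHORED point of `Ÿα`, `yβ` any point of `Ÿβ` and `σ ∈ Π^tp_{Xβ}`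
with `σ D_{yβ} σ⁻¹ ⊆ γ(D_{yα})`; let `δ : K̈^×_α → K̈^×_β` be induced by `γ` on the Kummer classes of
constants.  If a class `x` evaluates at `yα` to `v ∈ K̈^×_α`, then `σ⁻¹·T(x)` evaluates at `yβ` to `δ v`.
Proof: on `D_{yα}`, `x` IS the constant class of `v` (anchoring); transporting to `σ D_{yβ} σ⁻¹`
(`exists_transportAt`) and conjugating back by `σ⁻¹` (abc-iut-L2-d1's `ContH1.exists_conjTransport`) gives
`(σ⁻¹·T x)|_{D_{yβ}} = (σ⁻¹·κ(δ v))|_{D_{yβ}} = κ(δ v)|_{D_{yβ}}` (constants are fixed, Prop. 1.5 (ii)).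
[cite: MochizukiEtTh2009, Thm 1.10 (ii) p.30] -/
theorem evalAt_transport_eq (hCβ : Mβ.toThetaSetting.Compat) (h15iiβ : ThetaSetting.Prop15ii Eβ hCβ)
    (c : ThetaSetting.ThetaCompanion γ) (h : ThetaSetting.Thm16i γ) (δ : (↥Mα.Kdd)ˣ → (↥Mβ.Kdd)ˣ)
    (hδ : ∀ a : (↥Mα.Kdd)ˣ, ThetaSetting.transport c h
        (Mα.toThetaSetting.inflTheta Mα.toThetaSetting.GtpYdd (Eα.kumYdd (Eα.toKddHat a))) =
      Mβ.toThetaSetting.inflTheta Mβ.toThetaSetting.GtpYdd (Eβ.kumYdd (Eβ.toKddHat (δ a))))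
    (yα : ThetaSetting.AnchoredPoint Eα) (yβ : ThetaSetting.NonCuspidalPoint Eβ) (σ : Mβ.PiTemp)
    (hD : ∀ k : Mβ.PiTemp, σ⁻¹ * k * σ ∈ yβ.Dpt → γ.toMulEquiv.symm k ∈ yα.Dpt)
    {x : Mα.toThetaSetting.H1 Mα.toThetaSetting.GtpYdd} {v : (↥Mα.Kdd)ˣ}
    (hx : yα.evalAt (ContH1.res Mα.toTheta Mα.toThetaSetting.DeltaTheta yα.Dpt_le x) =
      Eα.toKddHat v) :
    haveI := hCβ.GtpYdd_normal
    yβ.evalAt (ContH1.res Mβ.toTheta Mβ.toThetaSetting.DeltaTheta yβ.Dpt_le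
      (ContH1.conj Mβ.toTheta Mβ.toThetaSetting.DeltaTheta σ⁻¹ (ThetaSetting.transport c h x))) =
      Eβ.toKddHat (δ v) := by
  haveI := hCβ.GtpYdd_normal
  -- (1) on `D_{yα}` the class `x` is the constant class of `v`
  have hxα : ContH1.res Mα.toTheta Mα.toThetaSetting.DeltaTheta yα.Dpt_le x =
      ContH1.res Mα.toTheta Mα.toThetaSetting.DeltaTheta yα.Dpt_le
        (Mα.toThetaSetting.inflTheta Mα.toThetaSetting.GtpYdd (Eα.kumYdd (Eα.toKddHat v))) :=
    yα.evalAt_injective (by rw [hx, yα.evalAt_kum])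
  -- (2) transport to `S = σ D_{yβ} σ⁻¹ ⊆ γ(D_{yα})`
  have hSle : yβ.Dpt.comap (MulAut.conj σ⁻¹).toMonoidHom ≤ Mβ.GtpYdd := by
    intro k hk
    simp only [Subgroup.mem_comap, MulEquiv.coe_toMonoidHom, MulAut.conj_apply, inv_inv] at hk
    have h' := (hCβ.GtpYdd_normal).conj_mem _ (yβ.Dpt_le hk) σ
    simpa [mul_assoc] using h'
  have hmap : ∀ k : Mβ.PiTemp, k ∈ yβ.Dpt.comap (MulAut.conj σ⁻¹).toMonoidHom →
      γ.toMulEquiv.symm k ∈ yα.Dpt := fun k hk => by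
    simp only [Subgroup.mem_comap, MulEquiv.coe_toMonoidHom, MulAut.conj_apply, inv_inv] at hk
    exact hD k hk
  obtain ⟨T₁, hT₁⟩ := ThetaSetting.exists_transportAt c h yα.Dpt_le hSle hmap
  have h1 : ContH1.res Mβ.toTheta Mβ.toThetaSetting.DeltaTheta hSle (ThetaSetting.transport c h x) =
      ContH1.res Mβ.toTheta Mβ.toThetaSetting.DeltaTheta hSle
        (Mβ.toThetaSetting.inflTheta Mβ.toThetaSetting.GtpYdd (Eβ.kumYdd (Eβ.toKddHat (δ v)))) := by
    rw [← hT₁, hxα, hT₁, hδ]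
  -- (3) conjugate back by `σ⁻¹` onto `D_{yβ}`; constants are fixed (Prop. 1.5 (ii))
  obtain ⟨T₂, hT₂⟩ := ContH1.exists_conjTransport Mβ.toTheta Mβ.toThetaSetting.DeltaTheta
    (N := Mβ.GtpYdd) σ⁻¹ yβ.Dpt_le hSle
  have h2 := congrArg T₂ h1
  rw [hT₂, hT₂, Mβ.conj_inflTheta_kumYdd_eq_self hCβ Eβ σ⁻¹ (δ v)
    (by rw [h15iiβ.Fdd2_eq]; exact ⟨_, rfl⟩)] at h2
  rw [h2, yβ.evalAt_kum]

/-- **The values of the orbit are transported by `δ`** (one inclusion): with `yα` anchored, `σ` over `Ẋβ`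
with `σ D_{yβ} σ⁻¹ ⊆ γ(D_{yα})`, and `γ` carrying elements over `Ẋα` to elements over `Ẋβ`,
`δ(η^{Z}|_{yα}) ⊆ (T η)^{Z}|_{yβ}` — since `T(s·x) = γ(s)·T(x)` (`transport_conj`) and `σ⁻¹ γ(s)` lies over
`Ẋβ`. [cite: MochizukiEtTh2009, Thm 1.10 (ii) p.30] -/
theorem image_valuesAt_subset (hCα : Mα.toThetaSetting.Compat) (hCβ : Mβ.toThetaSetting.Compat)
    (h15iiβ : ThetaSetting.Prop15ii Eβ hCβ) (c : ThetaSetting.ThetaCompanion γ)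
    (h : ThetaSetting.Thm16i γ) (δ : (↥Mα.Kdd)ˣ → (↥Mβ.Kdd)ˣ)
    (hδ : ∀ a : (↥Mα.Kdd)ˣ, ThetaSetting.transport c h
        (Mα.toThetaSetting.inflTheta Mα.toThetaSetting.GtpYdd (Eα.kumYdd (Eα.toKddHat a))) =
      Mβ.toThetaSetting.inflTheta Mβ.toThetaSetting.GtpYdd (Eβ.kumYdd (Eβ.toKddHat (δ a))))
    {εα : Mα.GtpC} {εβ : Mβ.GtpC}
    (hX : ∀ s : Mα.PiTemp, Mα.inclX s ∈ Mα.dotX εα → Mβ.inclX (γ.toMulEquiv s) ∈ Mβ.dotX εβ)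
    (yα : ThetaSetting.AnchoredPoint Eα) (yβ : ThetaSetting.NonCuspidalPoint Eβ) {σ : Mβ.PiTemp}
    (hσ : Mβ.inclX σ ∈ Mβ.dotX εβ)
    (hD : ∀ k : Mβ.PiTemp, σ⁻¹ * k * σ ∈ yβ.Dpt → γ.toMulEquiv.symm k ∈ yα.Dpt)
    (x : Mα.toThetaSetting.H1 Mα.toThetaSetting.GtpYdd) :
    δ '' Mα.valuesAt hCα εα x yα.toNonCuspidalPoint ⊆
      Mβ.valuesAt hCβ εβ (ThetaSetting.transport c h x) yβ := by
  haveI := hCα.GtpYdd_normal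
  haveI := hCβ.GtpYdd_normal
  rintro _ ⟨v, ⟨y, ⟨s, hs, rfl⟩, hy⟩, rfl⟩
  refine ⟨ContH1.conj Mβ.toTheta Mβ.toThetaSetting.DeltaTheta (σ⁻¹ * γ.toMulEquiv s)
      (ThetaSetting.transport c h x), ⟨σ⁻¹ * γ.toMulEquiv s, ?_, rfl⟩, ?_⟩
  · rw [map_mul, map_inv]
    exact (Mβ.dotX εβ).mul_mem ((Mβ.dotX εβ).inv_mem hσ) (hX s hs)
  · rw [ContH1.conj_mul_apply, ← ThetaSetting.transport_conj c h s x]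
    exact evalAt_transport_eq hCβ h15iiβ c h δ hδ yα yβ σ hD hy

/-! ## §C. Both inclusions by symmetry; the typed Thm. 1.10 (ii) -/

/-- The relation `γ(D_{yα}) = σ D_{yβ} σ⁻¹`, read as membership transport. [cite: MochizukiEtTh2009, Thm 1.10 (ii) p.30] -/
theorem symm_mem_Dpt_of_map_eq {yα : ThetaSetting.AnchoredPoint Eα} {yβ : ThetaSetting.AnchoredPoint Eβ}
    {σ : Mβ.PiTemp}
    (hDeq : yα.Dpt.map γ.toMulEquiv.toMonoidHom = yβ.Dpt.map (MulAut.conj σ).toMonoidHom)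
    (k : Mβ.PiTemp) (hk : σ⁻¹ * k * σ ∈ yβ.Dpt) : γ.toMulEquiv.symm k ∈ yα.Dpt := by
  have hk' : k ∈ yβ.Dpt.map (MulAut.conj σ).toMonoidHom :=
    ⟨σ⁻¹ * k * σ, hk, by simp [MulAut.conj_apply, mul_assoc]⟩
  rw [← hDeq] at hk'
  obtain ⟨d, hd, hdk⟩ := hk'
  have hd' : γ.toMulEquiv.symm k = d := by
    rw [← hdk]
    exact γ.toMulEquiv.symm_apply_apply d
  rw [hd']
  exact hd

/-- The same relation read for the INVERSE data `(γ⁻¹, (γ⁻¹σ)⁻¹)`. [cite: MochizukiEtTh2009, Thm 1.10 (ii) p.30] -/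
theorem mem_Dpt_of_map_eq {yα : ThetaSetting.AnchoredPoint Eα} {yβ : ThetaSetting.AnchoredPoint Eβ}
    {σ : Mβ.PiTemp}
    (hDeq : yα.Dpt.map γ.toMulEquiv.toMonoidHom = yβ.Dpt.map (MulAut.conj σ).toMonoidHom)
    (k : Mα.PiTemp) (hk : (γ.toMulEquiv.symm σ)⁻¹⁻¹ * k * (γ.toMulEquiv.symm σ)⁻¹ ∈ yα.Dpt) :
    γ.symm.toMulEquiv.symm k ∈ yβ.Dpt := by
  have hmem : γ.toMulEquiv ((γ.toMulEquiv.symm σ)⁻¹⁻¹ * k * (γ.toMulEquiv.symm σ)⁻¹) ∈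
      yα.Dpt.map γ.toMulEquiv.toMonoidHom := ⟨_, hk, rfl⟩
  rw [hDeq] at hmem
  obtain ⟨d, hd, hdk⟩ := hmem
  simp only [inv_inv, map_mul, map_inv, MulEquiv.apply_symm_apply, MulEquiv.coe_toMonoidHom,
    MulAut.conj_apply] at hdk
  have hd' : d = γ.toMulEquiv k := by
    have h1 := congrArg (fun t => σ⁻¹ * t * σ) hdk
    simpa [mul_assoc] using h1
  change γ.toMulEquiv k ∈ yβ.Dpt
  rw [← hd']
  exact hd

/-- **The values of the orbit at corresponding anchored points are in bijection via `δ`**: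
`δ(η^{Z}|_{yα}) = (T η)^{Z}|_{yβ}` whenever `γ(D_{yα}) = σ D_{yβ} σ⁻¹` with `σ` over `Ẋβ`, both points
ANCHORED — the inclusion `⊇` is `⊆` for the inverse data `(γ⁻¹, (γ^Θ)⁻¹, δ⁻¹)` (abc-iut's
`Thm16Sub.companionSymm`, `thm16i_symm`, `transport_symm_transport`). [cite: MochizukiEtTh2009, Thm 1.10 (ii) p.30] -/
theorem image_valuesAt_eq (hCα : Mα.toThetaSetting.Compat) (hCβ : Mβ.toThetaSetting.Compat)
    (h15iiα : ThetaSetting.Prop15ii Eα hCα) (h15iiβ : ThetaSetting.Prop15ii Eβ hCβ)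
    (c : ThetaSetting.ThetaCompanion γ) (h : ThetaSetting.Thm16i γ) (δ : (↥Mα.Kdd)ˣ ≃* (↥Mβ.Kdd)ˣ)
    (hδ : ∀ a : (↥Mα.Kdd)ˣ, ThetaSetting.transport c h
        (Mα.toThetaSetting.inflTheta Mα.toThetaSetting.GtpYdd (Eα.kumYdd (Eα.toKddHat a))) =
      Mβ.toThetaSetting.inflTheta Mβ.toThetaSetting.GtpYdd (Eβ.kumYdd (Eβ.toKddHat (δ a))))
    {εα : Mα.GtpC} {εβ : Mβ.GtpC}
    (hX : ∀ s : Mα.PiTemp, Mα.inclX s ∈ Mα.dotX εα ↔ Mβ.inclX (γ.toMulEquiv s) ∈ Mβ.dotX εβ)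
    (yα : ThetaSetting.AnchoredPoint Eα) (yβ : ThetaSetting.AnchoredPoint Eβ) {σ : Mβ.PiTemp}
    (hσ : Mβ.inclX σ ∈ Mβ.dotX εβ)
    (hDeq : yα.Dpt.map γ.toMulEquiv.toMonoidHom = yβ.Dpt.map (MulAut.conj σ).toMonoidHom)
    (x : Mα.toThetaSetting.H1 Mα.toThetaSetting.GtpYdd) :
    δ '' Mα.valuesAt hCα εα x yα.toNonCuspidalPoint =
      Mβ.valuesAt hCβ εβ (ThetaSetting.transport c h x) yβ.toNonCuspidalPoint := by
  refine Set.Subset.antisymm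
    (image_valuesAt_subset hCα hCβ h15iiβ c h δ hδ (fun s hs => (hX s).mp hs) yα
      yβ.toNonCuspidalPoint hσ (symm_mem_Dpt_of_map_eq hDeq) x) ?_
  -- the inverse data
  have hδ' : ∀ b : (↥Mβ.Kdd)ˣ, ThetaSetting.transport (Thm16Sub.companionSymm c) (Thm16Sub.thm16i_symm h)
      (Mβ.toThetaSetting.inflTheta Mβ.toThetaSetting.GtpYdd (Eβ.kumYdd (Eβ.toKddHat b))) =
      Mα.toThetaSetting.inflTheta Mα.toThetaSetting.GtpYdd (Eα.kumYdd (Eα.toKddHat (δ.symm b))) := by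
    intro b
    have hb := congrArg (ThetaSetting.transport (Thm16Sub.companionSymm c) (Thm16Sub.thm16i_symm h))
      (hδ (δ.symm b))
    rw [Thm16Sub.transport_symm_transport, MulEquiv.apply_symm_apply] at hb
    exact hb.symm
  have hX' : ∀ s : Mβ.PiTemp, Mβ.inclX s ∈ Mβ.dotX εβ →
      Mα.inclX (γ.symm.toMulEquiv s) ∈ Mα.dotX εα := fun s hs =>
    (hX (γ.toMulEquiv.symm s)).mpr (by rw [MulEquiv.apply_symm_apply]; exact hs)
  have hσ' : Mα.inclX (γ.toMulEquiv.symm σ)⁻¹ ∈ Mα.dotX εα := by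
    rw [map_inv]
    exact (Mα.dotX εα).inv_mem ((hX (γ.toMulEquiv.symm σ)).mpr
      (by rw [MulEquiv.apply_symm_apply]; exact hσ))
  have sub := image_valuesAt_subset hCβ hCα h15iiα (Thm16Sub.companionSymm c) (Thm16Sub.thm16i_symm h)
    δ.symm hδ' hX' yβ yα.toNonCuspidalPoint hσ' (mem_Dpt_of_map_eq hDeq) (ThetaSetting.transport c h x)
  rw [Thm16Sub.transport_symm_transport] at sub
  intro w hw
  exact ⟨δ.symm w, sub ⟨w, hw, rfl⟩, δ.apply_symm_apply w⟩

end MuTwoSetting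

section Thm110

variable {Mα Mβ : MuTwoSetting p} {εα : Mα.GtpC} {εβ : Mβ.GtpC} {hCα : Mα.toThetaSetting.Compat}
  {hCβ : Mβ.toThetaSetting.Compat} {Eα : Mα.toThetaSetting.EtaleThetaData}
  {Eβ : Mβ.toThetaSetting.EtaleThetaData} {γ : Mα.dotC εα ≃ₜ* Mβ.dotC εβ}

/-- `γ` carries the elements over `Ẋα` EXACTLY onto those over `Ẋβ` (`Γ(Π^tp_{Ẋα}) = Π^tp_{Ẋβ}`, Prop. 1.8,
`Γ` injective). [cite: MochizukiEtTh2009, Prop 1.8 p.28] -/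
theorem Thm110Hypothesis.inclX_mem_dotX_iff (H : Thm110Hypothesis εα εβ hCα hCβ Eα Eβ γ)
    (s : Mα.PiTemp) : Mα.inclX s ∈ Mα.dotX εα ↔ Mβ.inclX (H.γX.toMulEquiv s) ∈ Mβ.dotX εβ := by
  rw [H.γX_spec, ← H.preserves.map_dotX]
  constructor
  · exact fun hs => ⟨_, hs, rfl⟩
  · rintro ⟨g, hg, hgs⟩
    have hg' : g = Mα.inclX s := H.Γ.toMulEquiv.injective (by simpa using hgs)
    rw [← hg']
    exact hg

/-- The values of the TRANSPORTED orbit `T(η̈^{Θ,Z}_α)` at any point are the values of `η̈^{Θ,Z}_β`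
(the hypothesis «`γ` maps `η̈^{Θ,Z}_α ↦ η̈^{Θ,Z}_β`» and Rmk. 1.9.1). [cite: MochizukiEtTh2009, Thm 1.10 p.29] -/
theorem Thm110Hypothesis.valuesAt_transport_etaDd (H : Thm110Hypothesis εα εβ hCα hCβ Eα Eβ γ)
    (y : ThetaSetting.NonCuspidalPoint Eβ.toKummerData) :
    Mβ.valuesAt hCβ εβ (ThetaSetting.transport H.companion H.thm16i Eα.etaDd) y =
      Mβ.valuesAt hCβ εβ Eβ.etaDd y := by
  have hmem : ThetaSetting.transport H.companion H.thm16i Eα.etaDd ∈ Mβ.thetaOrbit hCβ εβ Eβ.etaDd :=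
    (H.maps_orbit _).mpr ⟨Eα.etaDd, MuTwoSetting.mem_thetaOrbit_self hCα εα Eα.etaDd, rfl⟩
  simp only [MuTwoSetting.valuesAt, MuTwoSetting.thetaOrbit_eq_of_mem hCβ εβ hmem]

/-- **Row T110.ii.r6 (forward) DERIVED**: `Thm110ValuesForward H Sα Sβ δ` at ANCHORED standard data from
`Thm110DeltaInduced H δ` (the constant-field isomorphism induced by `γ`), the decomposition-group transport
of `τα` AND of `τα⁻¹` onto `Π^tp_{Ẋβ}`-conjugates of `D_{τβ^{±1}}` (the `Thm110DecompTransport` shape, row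
r5), and Prop. 1.5 (ii) on both sides.  The «naturality of evaluation across `γ`» is no longer assumed.
[cite: MochizukiEtTh2009, Thm 1.10 (ii) p.30] -/
theorem thm110ValuesForward_of_decompTransport (H : Thm110Hypothesis εα εβ hCα hCβ Eα Eβ γ)
    (Aα : Mα.AnchoredStandardData Eα.toKummerData) (Aβ : Mβ.AnchoredStandardData Eβ.toKummerData)
    (h15iiα : ThetaSetting.Prop15ii Eα.toKummerData hCα)
    (h15iiβ : ThetaSetting.Prop15ii Eβ.toKummerData hCβ)
    (δ : (↥Mα.Kdd)ˣ ≃* (↥Mβ.Kdd)ˣ) (hδ : Thm110DeltaInduced H δ)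
    (hτ : Thm110DecompTransport H Aα.toStandardData Aβ.toStandardData)
    (hτ' : ∃ σ : Mβ.PiTemp, Mβ.inclX σ ∈ Mβ.dotX εβ ∧
      (Aα.tauInv.Dpt.map H.γX.toMulEquiv.toMonoidHom = Aβ.tau.Dpt.map (MulAut.conj σ).toMonoidHom ∨
        Aα.tauInv.Dpt.map H.γX.toMulEquiv.toMonoidHom =
          Aβ.tauInv.Dpt.map (MulAut.conj σ).toMonoidHom)) :
    Thm110ValuesForward H Aα.toStandardData Aβ.toStandardData δ := by
  refine ⟨hδ, fun V hV => ?_⟩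
  have key : ∀ (yα : ThetaSetting.AnchoredPoint Eα.toKummerData)
      (yβ : ThetaSetting.AnchoredPoint Eβ.toKummerData) (σ : Mβ.PiTemp), Mβ.inclX σ ∈ Mβ.dotX εβ →
      yα.Dpt.map H.γX.toMulEquiv.toMonoidHom = yβ.Dpt.map (MulAut.conj σ).toMonoidHom →
      δ '' Mα.valuesAt hCα εα Eα.etaDd yα.toNonCuspidalPoint =
        Mβ.valuesAt hCβ εβ Eβ.etaDd yβ.toNonCuspidalPoint := fun yα yβ σ hσ hD => by
    rw [MuTwoSetting.image_valuesAt_eq hCα hCβ h15iiα h15iiβ H.companion H.thm16i δ hδ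
      H.inclX_mem_dotX_iff yα yβ hσ hD, H.valuesAt_transport_etaDd]
  rcases hV with rfl | rfl
  · obtain ⟨σ, hσ, h | h⟩ := hτ
    · exact Or.inl (key Aα.tau Aβ.tau σ hσ h)
    · exact Or.inr (key Aα.tau Aβ.tauInv σ hσ h)
  · obtain ⟨σ, hσ, h | h⟩ := hτ'
    · exact Or.inl (key Aα.tauInv Aβ.tau σ hσ h)
    · exact Or.inr (key Aα.tauInv Aβ.tauInv σ hσ h)

/-- **[EtTh] Thm. 1.10 (ii) — the typed F-0514 `Thm110ii` — at anchored standard data, from the transport of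
CONSTANTS (`Thm110DeltaInduced H δ`) and of the DECOMPOSITION GROUPS of `τ^{±1}` (row r5 shape), with
Prop. 1.5 (ii) on both sides.**  No statement about values of the theta function is assumed: the values
travel with the restricted constant classes. [cite: MochizukiEtTh2009, Thm 1.10 (ii) p.30] -/
theorem thm110ii_of_decompTransport (H : Thm110Hypothesis εα εβ hCα hCβ Eα Eβ γ)
    (Aα : Mα.AnchoredStandardData Eα.toKummerData) (Aβ : Mβ.AnchoredStandardData Eβ.toKummerData)
    (h15iiα : ThetaSetting.Prop15ii Eα.toKummerData hCα)
    (h15iiβ : ThetaSetting.Prop15ii Eβ.toKummerData hCβ)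
    (δ : (↥Mα.Kdd)ˣ ≃* (↥Mβ.Kdd)ˣ) (hδ : Thm110DeltaInduced H δ)
    (hτ : Thm110DecompTransport H Aα.toStandardData Aβ.toStandardData)
    (hτ' : ∃ σ : Mβ.PiTemp, Mβ.inclX σ ∈ Mβ.dotX εβ ∧
      (Aα.tauInv.Dpt.map H.γX.toMulEquiv.toMonoidHom = Aβ.tau.Dpt.map (MulAut.conj σ).toMonoidHom ∨
        Aα.tauInv.Dpt.map H.γX.toMulEquiv.toMonoidHom =
          Aβ.tauInv.Dpt.map (MulAut.conj σ).toMonoidHom)) :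
    Thm110ii H Aα.toStandardData Aβ.toStandardData :=
  thm110ii_of_valuesForward
    (thm110ValuesForward_of_decompTransport H Aα Aβ h15iiα h15iiβ δ hδ hτ hτ')

end Thm110

end Literature.AnabelianGeometry.EtaleTheta

end
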